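import Summits.BirchSwinnertonDyer.BirchSwinnertonDyer.Theorems.GenusKolyvaginAtTwoGenusPrimitiveSupplyAtTwoTwoTranspositionIff
import Literature.NumberTheory.EllipticCurves.SubgroupSelmerCocycleCriteriaProofs
import HarnessLib

/-!
# Route `GenusKolyvaginAtTwo`, crux #2 `GenusPrimitiveSupplyAtTwo` (stmt-BirchSwinnertonDyer-22136):
# THE COCYCLE STEP of the hard half of the one-place dictionary — a Kummer class in Mazur–Rubin's twisted local condition is the
# Kummer class of a `χ`-NORM: `2Q = S + τS` with `S` fixed by `ker χ`

Width seat `bsd-line-gk2-p4` g14 (cell `bsd-f1-sign2`), step (a′) of the plan in `Lines/genus-supply-transposition-door-g14.md` §6. THEOREMS ONLY;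
helper `--supports stmt-BirchSwinnertonDyer-22136`; no item is closed; BSD is not proved by any of this.

WHAT. `exists_norm_form_of_mem_primeTwist_selmerLocalKer`: for `W/K`, a quadratic character `χ : Γ_K → ℤ/2`, a `K`-field `E`, a class `c ∈ H¹(K, E[2])`
lying in `PrimeTwist.selmerLocalKer W χ E` (it dies in `H¹(Γ_E, A_χ(K̄_E))`) whose restriction to `Γ_E` is the local Kummer class of `Q`
(`2Q = R ∈ E(E)`): there is `S ∈ E(K̄_E)` FIXED by `ker χ|_{Γ_E}` with `R = S + τS` for every `τ ∈ Γ_E` off `ker χ` — i.e. `R` is a norm from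
`E(E(√d))` when `χ` cuts out `E(√d)`. Proof: the twisted coboundary `f = (P, −P) ∈ A_χ` with `z(σ) = σ⋆f − f` reads `σQ − Q = σP − P` on `ker χ`
and `τQ − Q = −τP − P` off it; `S = Q − P`. (Step (b′), Kramer's «norms from a ramified extension are doubles», then gives `R ∈ 2E(E)`.)

References: [MazurRubin2007] §3, Def. 4.3, §5; [Kramer1981] Prop. 3; [SerreGaloisCohomology1997] I §2.4.
-/

set_option linter.dupNamespace false -- tree convention: `Summit.BirchSwinnertonDyer.BirchSwinnertonDyer.Theorems` (summit = sub-problem)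
set_option autoImplicit false

noncomputable section

open scoped Classical ContRepresentation

namespace Summit.BirchSwinnertonDyer.BirchSwinnertonDyer.Theorems.GenusKolyTransp

open WeierstrassCurve Field
open Literature.NumberTheory.EllipticCurves Literature.NumberTheory.GaloisRepresentations
open Literature.NumberTheory.GaloisCohomology
open Literature.NumberTheory.EllipticCurves.CocycleCriteria (resH1Hom_oneCocycleClass_eq_zero_iff)

universe u

/-- In `Multiplicative (ℤ/2)` a non-identity element is `ofAdd 1`. [folklore] -/
private theorem mult_zmod_two_eq_ofAdd_one {u : Multiplicative (ZMod 2)} (hu : u ≠ 1) : u = Multiplicative.ofAdd 1 := by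
  revert u; decide

/-- `0 − 1 = 1` in `ℤ/2`. [folklore] -/
private theorem zmod_two_zero_sub_one : (0 : ZMod 2) - 1 = 1 := by decide

/-- `(ofAdd 1)⁻¹ · (ofAdd 1)⁻¹ = 1` in `Multiplicative (ℤ/2)`. [folklore] -/
private theorem mult_zmod_two_inv_mul_inv :
    (Multiplicative.ofAdd (1 : ZMod 2))⁻¹ * (Multiplicative.ofAdd (1 : ZMod 2))⁻¹ = 1 := by decide

/-! ## §32 The cocycle step: twisted coboundary + Kummer coboundary ⟹ norm form -/

/-- **A Kummer class in the twisted local condition is the class of a `χ`-norm.** See the module docstring.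
[cite: MazurRubin2007, Def 4.3 and §5] [cite: Kramer1981, Prop. 3] -/
theorem exists_norm_form_of_mem_primeTwist_selmerLocalKer {K : Type u} [Field K] [CharZero K] (W : WeierstrassCurve K) [W.IsElliptic]
    (χ : Field.absoluteGaloisGroup K →ₜ* Multiplicative (ZMod 2)) (E : Type u) [Field E] [Algebra K E]
    (h2 : ((2 : ℕ) : ℤ) ≠ 0)
    {c : W.galH1Torsion ((2 : ℕ) : ℤ)} (hc : c ∈ PrimeTwist.selmerLocalKer W χ E)
    {Q : localPoints W E} (hQ : ((2 : ℕ) : ℤ) • Q ∈ MulAction.fixedPoints (absoluteGaloisGroup E) (localPoints W E))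
    (hcQ : galoisCohomology.res (W.torsionGaloisModule ((2 : ℕ) : ℤ)) E 1 c = W.localKummerClass ((2 : ℕ) : ℤ) h2 Q hQ) :
    ∃ S : localPoints W E, (∀ σ : absoluteGaloisGroup E, PrimeTwist.localChar χ E σ = 1 → σ • S = S) ∧
      ∀ τ : absoluteGaloisGroup E, PrimeTwist.localChar χ E τ ≠ 1 → ((2 : ℕ) : ℤ) • Q = S + τ • S := by
  haveI : Fact (Nat.Prime 2) := ⟨Nat.prime_two⟩
  obtain ⟨z, rfl⟩ := oneCocycleClass_surjective (discreteTopRep (absoluteGaloisGroup K) (geomTorsion W ((2 : ℕ) : ℤ))) c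
  -- Kummer side: `pointsMap (z (res σ)) = σQ' − Q'` with `Q' = Q + T₀`, `2Q' = 2Q`
  rw [res_torsionGaloisModule_oneCocycleClass, localKummerClass, ← sub_eq_zero] at hcQ
  have hcQ' : oneCocycleClass _ (contOneCocycles.pullback (absGaloisRestrict K E)
      (X := discreteTopRep (absoluteGaloisGroup K) (geomTorsion W ((2 : ℕ) : ℤ)))
      (Y := DiscreteGaloisModule.toTopRep (GaloisRep.restrictField E (W.torsionGaloisModule ((2 : ℕ) : ℤ))))
      (TopRep.ofHom ⟨ContinuousLinearMap.id ℤ (geomTorsion W ((2 : ℕ) : ℤ)), fun _ => rfl⟩) z -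
      W.localKummerCocycle ((2 : ℕ) : ℤ) h2 Q hQ) = 0 := by
    rw [oneCocycleClass_sub]
    exact hcQ
  obtain ⟨T₀, hT₀⟩ := (oneCocycleClass_eq_zero_iff _ _).mp hcQ'
  have hkum : ∀ σ : absoluteGaloisGroup E,
      pointsMap W E ((z.1 (resGal (K := K) E σ) : geomTorsion W ((2 : ℕ) : ℤ)) : geomPoints W) =
        σ • (Q + pointsMap W E ((T₀ : geomTorsion W ((2 : ℕ) : ℤ)) : geomPoints W)) -
          (Q + pointsMap W E ((T₀ : geomTorsion W ((2 : ℕ) : ℤ)) : geomPoints W)) := by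
    intro σ
    have h := hT₀ σ
    have h' : z.1 (resGal (K := K) E σ) - (W.localKummerCocycle ((2 : ℕ) : ℤ) h2 Q hQ).1 σ =
        resGal (K := K) E σ • T₀ - T₀ := h
    have h'' := congrArg (fun T : geomTorsion W ((2 : ℕ) : ℤ) ↦ pointsMap W E (T : geomPoints W)) h'
    simp only [AddSubgroupClass.coe_sub, map_sub] at h''
    rw [Literature.NumberTheory.EllipticCurves.AddSubgroup.torsionBy.coe_smul, pointsMap_smul] at h''
    have hκ : pointsMap W E (((W.localKummerCocycle ((2 : ℕ) : ℤ) h2 Q hQ).1 σ : geomTorsion W ((2 : ℕ) : ℤ)) : geomPoints W) =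
        σ • Q - Q := W.pointsMap_localKummerCocycle_apply ((2 : ℕ) : ℤ) h2 Q hQ σ
    have hκ' : pointsMap W E (((W.localKummerCocycle ((2 : ℕ) : ℤ) h2 Q hQ : _ → _) σ : geomTorsion W ((2 : ℕ) : ℤ)) :
        geomPoints W) = σ • Q - Q := hκ
    rw [hκ'] at h''
    rw [smul_add]
    linear_combination (norm := abel_nf) h''
  -- `2 (Q + T₀) = 2 Q`
  have h2T : ((2 : ℕ) : ℤ) • pointsMap W E ((T₀ : geomTorsion W ((2 : ℕ) : ℤ)) : geomPoints W) = 0 := by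
    have hT : ((2 : ℕ) : ℤ) • ((T₀ : geomTorsion W ((2 : ℕ) : ℤ)) : geomPoints W) = 0 := (T₀ : geomTorsion W ((2 : ℕ) : ℤ)).2
    rw [← map_zsmul, hT, map_zero]
  -- twisted side: `ψ (z (res σ)) = σ ⋆ f − f` for some `f = (P, −P) ∈ A_χ(K̄_E)`
  rw [PrimeTwist.selmerLocalKer, resKer_eq_ker, AddMonoidHom.mem_ker] at hc
  obtain ⟨f, hf⟩ := (resH1Hom_oneCocycleClass_eq_zero_iff _ _ _ z).mp hc
  set fR : PrimeTwist.ResPoints (PrimeTwist.localChar χ E) (localPoints W E) :=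
    (f : PrimeTwist.ResPoints (PrimeTwist.localChar χ E) (localPoints W E)) with hfR
  have hsum : fR 0 + fR 1 = 0 := by
    have h := (PrimeTwist.mem_points_iff _ _ fR).mp f.2
    have h01 : ∑ i : ZMod 2, fR i = fR 0 + fR 1 := Fin.sum_univ_two _
    rw [h01] at h
    exact h
  have htw : ∀ σ : absoluteGaloisGroup E,
      pointsMap W E ((z.1 (resGal (K := K) E σ) : geomTorsion W ((2 : ℕ) : ℤ)) : geomPoints W) =
        σ • fR (0 - PrimeTwist.ResPoints.expo (PrimeTwist.localChar χ E : absoluteGaloisGroup E →* Multiplicative (ZMod 2)) σ) - fR 0 := by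
    intro σ
    have h := congrArg (fun g : PrimeTwist.localModule W χ E ↦
      (g : PrimeTwist.ResPoints (PrimeTwist.localChar χ E) (localPoints W E)) 0) (hf σ)
    simp only [AddSubgroupClass.coe_sub, PrimeTwist.points.coe_smul, PrimeTwist.ResPoints.sub_apply,
      PrimeTwist.ResPoints.smul_apply'] at h
    rw [← h]
    rfl
  -- the point `P = f 0`, `f 1 = −P`, and `S = Q' − P`
  set Q' : localPoints W E := Q + pointsMap W E ((T₀ : geomTorsion W ((2 : ℕ) : ℤ)) : geomPoints W) with hQ'
  refine ⟨Q' - fR 0, fun σ hσ ↦ ?_, fun τ hτ ↦ ?_⟩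
  · -- on `ker χ`: `σQ' − Q' = σP − P`
    have h1 := hkum σ
    have h2 := htw σ
    have hexp : PrimeTwist.ResPoints.expo (PrimeTwist.localChar χ E : absoluteGaloisGroup E →* Multiplicative (ZMod 2)) σ = 0 := by
      rw [PrimeTwist.ResPoints.expo, show (PrimeTwist.localChar χ E : absoluteGaloisGroup E →* Multiplicative (ZMod 2)) σ = 1 from hσ, toAdd_one]
    rw [hexp, sub_zero] at h2
    rw [h1] at h2
    rw [smul_sub]
    linear_combination (norm := abel_nf) h2
  · -- off `ker χ`: `τQ' − Q' = −τP − P`, so `τ (Q' + P) = Q' − P` and `2Q = 2Q' = S + τ S`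
    have hval : (PrimeTwist.localChar χ E : absoluteGaloisGroup E →* Multiplicative (ZMod 2)) τ = Multiplicative.ofAdd 1 :=
      mult_zmod_two_eq_ofAdd_one hτ
    have hexp : PrimeTwist.ResPoints.expo (PrimeTwist.localChar χ E : absoluteGaloisGroup E →* Multiplicative (ZMod 2)) τ = 1 := by
      rw [PrimeTwist.ResPoints.expo, hval, toAdd_ofAdd]
    have h1 := hkum τ
    have h2 := htw τ
    rw [hexp, zmod_two_zero_sub_one] at h2
    have hf1 : fR 1 = -fR 0 := by linear_combination (norm := abel_nf) hsum
    rw [hf1, h1, smul_neg] at h2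
    -- `h2 : τ Q' − Q' = −τP − P`
    -- `τ⁻² ∈ ker χ` fixes `S`
    have hτ2 : (PrimeTwist.localChar χ E : absoluteGaloisGroup E →* Multiplicative (ZMod 2)) (τ⁻¹ * τ⁻¹) = 1 := by
      rw [map_mul, map_inv, hval]; exact mult_zmod_two_inv_mul_inv
    have hS := (show ∀ σ : absoluteGaloisGroup E, PrimeTwist.localChar χ E σ = 1 → σ • (Q' - fR 0) = Q' - fR 0 from
      fun σ hσ ↦ by
        have h1 := hkum σ
        have h2 := htw σ
        have hexp : PrimeTwist.ResPoints.expo (PrimeTwist.localChar χ E : absoluteGaloisGroup E →* Multiplicative (ZMod 2)) σ = 0 := by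
          rw [PrimeTwist.ResPoints.expo, show (PrimeTwist.localChar χ E : absoluteGaloisGroup E →* Multiplicative (ZMod 2)) σ = 1 from hσ,
            toAdd_one]
        rw [hexp, sub_zero] at h2
        rw [h1] at h2
        rw [smul_sub]
        linear_combination (norm := abel_nf) h2) (τ⁻¹ * τ⁻¹) hτ2
    -- `τ • S = τ⁻¹ • S`
    have hτS : τ • (Q' - fR 0) = τ⁻¹ • (Q' - fR 0) := by
      conv_lhs => rw [← hS, ← mul_smul, ← mul_assoc, mul_inv_cancel, one_mul]
    -- `τ⁻¹ • S = Q' + P` from `τ (Q' + P) = S`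
    have hτinv : τ⁻¹ • (Q' - fR 0) = Q' + fR 0 := by
      have h3 : τ • (Q' + fR 0) = Q' - fR 0 := by
        rw [smul_add]
        linear_combination (norm := abel_nf) h2
      rw [← h3, ← mul_smul, inv_mul_cancel, one_smul]
    rw [hτS, hτinv]
    -- `2Q = 2Q' = (Q' − P) + (Q' + P)`
    have h2Q : ((2 : ℕ) : ℤ) • Q = ((2 : ℕ) : ℤ) • Q' := by
      rw [hQ', smul_add, h2T, add_zero]
    rw [h2Q]
    simp only [Nat.cast_ofNat, two_zsmul]
    abel

end Summit.BirchSwinnertonDyer.BirchSwinnertonDyer.Theorems.GenusKolyTransp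

end
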